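import Literature.Computability.Cryptography.IndistinguishabilityObfuscatorSubexp

/-!
# `WbwObfuscatedGluedTrees` (stmt-QuantumAdvantage-2340) — VI: keyed hybrid steps from worst-case advice

Support lemma for the INFORMAL crux `WbwObfuscatedGluedTrees` of route
`Summits/QuantumAdvantage/QuantumAdvantage/Theses/WhiteBoxWalk` (refuter work file
`Summits/QuantumAdvantage/QuantumAdvantage/Cruxes/WbwObfuscatedGluedTrees/Disproof.lean`, §4,
"quantifier-order obligation", cycle 2, refuter-cdisprove-stmt-QuantumAdvantage-2340-g2-0).
Sorry-free; no Theses decl is asserted; imports only the tree's `(t, δ)`-secure iO vocabulary.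

THE OBLIGATION. The tree's `CircuitObfuscator.IsSecureIndistinguishable t δ 𝒞` (BPR15 Def. 4.1 in
JLS form) fixes the distinguisher `D` and its advice sequence `a` BEFORE the universally quantified
pair `(C₀, C₁)`, and hands `D` only `(a κ, 1^κ, code of O(C_b))`. Every hybrid step of a would-be
proof of clause (C) for the obfuscated glued-trees generator — and the refuter's one-iO-to-all-iO
transfer of attacks — compares `O(C₀^k)` with `O(C₁^k)` for circuits depending on a secret KEY `k`
(one of exponentially many per security parameter), in front of an adversary that needs
key-dependent side information (`name_k(ENTRANCE)`). `IsSecureIndistinguishable.keyed_family` is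
the form such steps consume: for a keyed family of admissible pairs and key-dependent advice strings
of admissible length, the `(t, δ)` bound holds for all sufficiently large `κ` SIMULTANEOUSLY for all
keys — because the advantage depends on the advice sequence only through its `κ`-th entry
(`ioAdvantageAdv_congr_advice`), so the single advice sequence "advice of a key maximising the gap
at `κ`" dominates every key (worst-case-key advice; the classical averaging argument that lets a
non-uniform distinguisher hard-wire the worst key). Averaging over the key then costs nothing:
`avg_k gap_k ≤ max_k gap_k ≤ δ κ`.
-/

set_option linter.dupNamespace false

namespace Summit.QuantumAdvantage.QuantumAdvantage.Theorems.WbwObfuscatedGluedTrees.Negative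

open Literature.Computability.Cryptography Literature.Computability.Complexity
open Filter _root_.Computability

namespace KeyedIndistinguishability

variable (O : CircuitObfuscator)

/-- The advised iO advantage depends on the advice sequence only through its `κ`-th entry.
[folklore] -/
theorem ioAdvantageAdv_congr_advice (D : RandAlg (List Bool) Bool) {a a' : ℕ → List Bool} {κ : ℕ}
    (h : a κ = a' κ) {n : ℕ} (C₀ C₁ : Circuit (Fin n)) :
    O.ioAdvantageAdv D a κ C₀ C₁ = O.ioAdvantageAdv D a' κ C₀ C₁ := by
  simp only [CircuitObfuscator.ioAdvantageAdv, acceptPMFAdv, h]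

variable {O}

/-- **Keyed families from worst-case advice.** Let `O` be `(t, δ)`-indistinguishable on `𝒞` and
`D` a PPT distinguisher. For every family, indexed by `κ` and a key `k` from a finite set `keys κ`,
of same-size functionally equivalent pairs `(C₀ κ k, C₁ κ k)` in `𝒞 κ`, and key-dependent advice
strings `adv κ k` of length `≤ t κ` (all keys, all large `κ`), the bound
`ioAdvantageAdv D (advice adv κ k) κ (C₀ κ k) (C₁ κ k) ≤ δ κ` holds for all sufficiently large `κ`
and ALL keys `k ∈ keys κ` at once. Proof: apply the definition to the single advice sequence
`κ ↦ adv κ k*(κ)` with `k*(κ)` a key maximising the gap at `κ`. [folklore] -/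
theorem keyed_family {t δ : ℕ → ℝ} {𝒞 : ℕ → Set SizedCircuit}
    (h : O.IsSecureIndistinguishable t δ 𝒞) (D : RandAlg (List Bool) Bool)
    (hD : IsPPT D encodeBool) (ht : ∀ᶠ κ in atTop, (0 : ℝ) ≤ t κ)
    {K : Type*} (keys : ℕ → Finset K) (adv : ℕ → K → List Bool)
    (hadv : ∀ᶠ κ in atTop, ∀ k ∈ keys κ, ((adv κ k).length : ℝ) ≤ t κ)
    (m : ℕ → K → ℕ) (C₀ C₁ : ∀ κ k, Circuit (Fin (m κ k)))
    (h₀ : ∀ κ, ∀ k ∈ keys κ, (⟨m κ k, C₀ κ k⟩ : SizedCircuit) ∈ 𝒞 κ)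
    (h₁ : ∀ κ, ∀ k ∈ keys κ, (⟨m κ k, C₁ κ k⟩ : SizedCircuit) ∈ 𝒞 κ)
    (hs : ∀ κ, ∀ k ∈ keys κ, (C₀ κ k).size = (C₁ κ k).size)
    (he : ∀ κ, ∀ k ∈ keys κ, ∀ x, (C₀ κ k).eval x = (C₁ κ k).eval x) :
    ∀ᶠ κ in atTop, ∀ k ∈ keys κ,
      O.ioAdvantageAdv D (fun _ => adv κ k) κ (C₀ κ k) (C₁ κ k) ≤ δ κ := by
  classical
  -- the gap of key `k` at `κ`, with its own advice
  set G : ∀ κ, K → ℝ := fun κ k => O.ioAdvantageAdv D (fun _ => adv κ k) κ (C₀ κ k) (C₁ κ k)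
    with hG
  -- a key maximising the gap at `κ` (junk when `keys κ = ∅`)
  have hmax : ∀ κ, (keys κ).Nonempty → ∃ k ∈ keys κ, ∀ k' ∈ keys κ, G κ k' ≤ G κ k :=
    fun κ hne => Finset.exists_max_image (keys κ) (G κ) hne
  let kstar : ℕ → Option K := fun κ =>
    if hne : (keys κ).Nonempty then some (hmax κ hne).choose else none
  let a : ℕ → List Bool := fun κ =>
    match kstar κ with
    | some k => adv κ k
    | none => []
  have hkstar : ∀ κ, (keys κ).Nonempty → ∃ k ∈ keys κ, kstar κ = some k ∧
      ∀ k' ∈ keys κ, G κ k' ≤ G κ k := by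
    intro κ hne
    refine ⟨(hmax κ hne).choose, (hmax κ hne).choose_spec.1, ?_, (hmax κ hne).choose_spec.2⟩
    simp only [kstar, dif_pos hne]
  have ha_len : ∀ᶠ κ in atTop, ((a κ).length : ℝ) ≤ t κ := by
    filter_upwards [hadv, ht] with κ hκ hκt
    by_cases hne : (keys κ).Nonempty
    · obtain ⟨k, hk, hks, -⟩ := hkstar κ hne
      have : a κ = adv κ k := by simp only [a, hks]
      rw [this]
      exact hκ k hk
    · have : kstar κ = none := by simp only [kstar, dif_neg hne]
      have ha : a κ = [] := by simp only [a, this]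
      rw [ha]
      simpa using hκt
  filter_upwards [h D hD a ha_len] with κ hκ k hk
  have hne : (keys κ).Nonempty := ⟨k, hk⟩
  obtain ⟨ks, hks, hkss, hmaxk⟩ := hkstar κ hne
  have hak : a κ = adv κ ks := by simp only [a, hkss]
  calc O.ioAdvantageAdv D (fun _ => adv κ k) κ (C₀ κ k) (C₁ κ k)
      = G κ k := rfl
    _ ≤ G κ ks := hmaxk k hk
    _ = O.ioAdvantageAdv D a κ (C₀ κ ks) (C₁ κ ks) := by
        rw [hG]
        exact ioAdvantageAdv_congr_advice O D (a := fun _ => adv κ ks) (a' := a) hak.symm _ _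
    _ ≤ δ κ := hκ (m κ ks) (C₀ κ ks) (C₁ κ ks) (h₀ κ ks hks) (h₁ κ ks hks) (hs κ ks hks) (he κ ks hks)

/-- The same for a sub-exponentially secure iO (`IsSubexpIO ε 𝒞 O`): keyed families of admissible
pairs with advice of length `≤ 2^{κ^ε}` have all their gaps `≤ 2^{-κ^ε}` eventually, uniformly in
the key. [folklore] -/
theorem keyed_family_subexp {ε : ℝ} {𝒞 : ℕ → Set SizedCircuit} (h : IsSubexpIO ε 𝒞 O)
    (D : RandAlg (List Bool) Bool) (hD : IsPPT D encodeBool)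
    {K : Type*} (keys : ℕ → Finset K) (adv : ℕ → K → List Bool)
    (hadv : ∀ᶠ κ in atTop, ∀ k ∈ keys κ, ((adv κ k).length : ℝ) ≤ (2 : ℝ) ^ ((κ : ℝ) ^ ε))
    (m : ℕ → K → ℕ) (C₀ C₁ : ∀ κ k, Circuit (Fin (m κ k)))
    (h₀ : ∀ κ, ∀ k ∈ keys κ, (⟨m κ k, C₀ κ k⟩ : SizedCircuit) ∈ 𝒞 κ)
    (h₁ : ∀ κ, ∀ k ∈ keys κ, (⟨m κ k, C₁ κ k⟩ : SizedCircuit) ∈ 𝒞 κ)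
    (hs : ∀ κ, ∀ k ∈ keys κ, (C₀ κ k).size = (C₁ κ k).size)
    (he : ∀ κ, ∀ k ∈ keys κ, ∀ x, (C₀ κ k).eval x = (C₁ κ k).eval x) :
    ∀ᶠ κ in atTop, ∀ k ∈ keys κ,
      O.ioAdvantageAdv D (fun _ => adv κ k) κ (C₀ κ k) (C₁ κ k) ≤ (2 : ℝ) ^ (-((κ : ℝ) ^ ε)) :=
  keyed_family h.indist D hD (Eventually.of_forall fun κ => by positivity) keys adv hadv m C₀ C₁
    h₀ h₁ hs he

end KeyedIndistinguishability

end Summit.QuantumAdvantage.QuantumAdvantage.Theorems.WbwObfuscatedGluedTrees.Negative
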